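import Mathlib
import Summits.ResolutionOfSingularities.ResolutionOfSingularities.Theorems.HomologicalConductorPersistenceKC3Upper
import Summits.ResolutionOfSingularities.ResolutionOfSingularities.Theorems.HomologicalConductorPersistenceJacobianKept
import HarnessLib

/-!
# Crux `Persistence` (stmt-ResolutionOfSingularities-16484) — w44b K-C3, K2-UPPER COMPLETE (fact-free, affine):
# `caᵐ(k[x,y,z,t]/(xy − z³ − t⁴)) ⊆ (x, y, z², zt, t²)` for every `m` and every field `k`

Route `ResolutionOfSingularities/HomologicalConductor`, chain W4.4b (cell `res-hironaka`), crux `Persistence`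
(stmt-ResolutionOfSingularities-16484), KILL CANDIDATE K-C3 (CHAIN w44b v13.2 §V13.10), item K2 («`ca(T₀) = I·T₀`»,
`I = (x, y, z², zt, t²)`): the WHOLE UPPER HALF `ca ⊆ I` at the affine ring `A = k[x,y,z,t]/(x y − z³ − t⁴)`, with no
homogeneity / torus lemma and no printed input. res-type-010, OFFER → TAKING-UNLESS-OBJECTED 2026-08-27T11:34:58Z.
OURS; nothing here is a statement of the manuscript under review (Hironaka 2017) and no statement of that manuscript is
used; AI-written, weaker than expert review. Filed `--supports stmt-ResolutionOfSingularities-16484 --as helper`.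

PROOF. Let `ā ∈ caᵐ(A)`, `a ∈ S′ = k[x,y,z,t]`. Write `a = ι(π a) + b` with `π : x, y ↦ 0` the retraction onto
`S = k[z,t]`, `ι` the inclusion and `b ∈ (x, y)` (`sub_inclusion_retraction_mem`). By res-D-pv-058's K1
(`PersistenceJacobianKept.pderiv_mem_cohomologyAnnihilatorOfDegree`: `∂f/∂y = x`, `∂f/∂x = y`) `x̄, ȳ ∈ ca⁴(A)`, so
`ι(π a)‾ ∈ ca^{max(m,4)}(A)`. By the CONDUCTOR CRITERION of `…KC3Upper` (p527657, res-type-010: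
`not_mem_cohomologyAnnihilatorOfDegree_of_map_not_mem` with the test map `τ : z ↦ −τ⁴, t ↦ τ³`) this forces
`(π a)(−τ⁴, τ³) ∈ (τ⁶)`, and the COEFFICIENT LEMMA `mem_J_of_test_mem` (reading the coefficients of `1, τ³, τ⁴`, the
only weights `4i + 3j ≤ 5`) gives `π a ∈ (z², zt, t²)`; hence `a ∈ ι((z,t)²) + (x, y) = I`.

* `lowTerms`-free bookkeeping: `sub_low_mem_J` (`c − (c₀ + c_z z + c_t t) ∈ J := (z², zt, t²)`, by
  `MvPolynomial.induction_on'`), `map_J_le` (`τ(J) ⊆ (τ⁶)`), **`mem_J_of_test_mem`** (`τ c ∈ (τ⁶) ⇒ c ∈ J`);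
* `sub_inclusion_retraction_mem` (`a − ι(π a) ∈ (x, y)`), `pderiv_one_f`, `pderiv_zero_f`, `mk_X0_mem`, `mk_X1_mem`;
* **`cohomologyAnnihilatorOfDegree_le_map_I`** — `caᵐ(A) ≤ I·A` for every field `k`, every `m`;
  **`cohomologyAnnihilator_le_map_I`** — `ca(A) ≤ I·A`.
Together with res-type-011's F-DP parts 3–4 (the lower half `I ⊆ ca` at the completion, modulo the Esentepe named facts)
this makes K2 two-sided; the upper half here is unconditional.

References (mechanism only): res-L1-w44b-plan-1 CHAIN w44b v13.2 §V13.10; res-L1-w44b-tri-1 REFEREE-KC3 (OURS).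
-/

noncomputable section

-- single-problem summit: the doubled namespace component `ResolutionOfSingularities` is forced
set_option linter.dupNamespace false

namespace Summit.ResolutionOfSingularities.ResolutionOfSingularities.Theorems.HomologicalConductor.KC3Upper

open MvPolynomial
open Literature.RingTheory.CohomologyAnnihilator
open Summit.ResolutionOfSingularities.ResolutionOfSingularities.Theorems.HomologicalConductor.PersistenceJacobianKept

universe u

section Curve

variable (k : Type u) [CommRing k]

/-! ## The ideal `J = (z², zt, t²) ⊂ k[z,t]` in monomial form and the low-terms decomposition -/

/-- `c − (c₀ + c_z·z + c_t·t) ∈ J = (z², zt, t²)` for every `c ∈ k[z,t]` (`z = X 0`, `t = X 1`; `J` spanned by the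
monomials `z², zt, t²`): every monomial other than `1, z, t` is divisible by one of `z², zt, t²`. [folklore] -/
theorem sub_low_mem_J (c : MvPolynomial (Fin 2) k) :
    c - (C (coeff 0 c) + C (coeff (Finsupp.single 0 1) c) * X 0 + C (coeff (Finsupp.single 1 1) c) * X 1) ∈
      Ideal.span ((fun s => monomial s (1 : k)) ''
        ({Finsupp.single 0 2, Finsupp.single 0 1 + Finsupp.single 1 1, Finsupp.single 1 2} :
          Set (Fin 2 →₀ ℕ))) := by
  induction c using MvPolynomial.induction_on' with
  | monomial u a =>
    have he0 : (Finsupp.single (0 : Fin 2) 1 : Fin 2 →₀ ℕ) ≠ 0 := by simp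
    have he1 : (Finsupp.single (1 : Fin 2) 1 : Fin 2 →₀ ℕ) ≠ 0 := by simp
    have he01 : (Finsupp.single (0 : Fin 2) 1 : Fin 2 →₀ ℕ) ≠ Finsupp.single 1 1 := by
      rw [Ne, Finsupp.single_left_inj one_ne_zero]; decide
    by_cases hu0 : u = 0
    · subst hu0
      simp [he0.symm, he1.symm]
    by_cases hu1 : u = Finsupp.single 0 1
    · subst hu1
      simp [MvPolynomial.coeff_monomial, he0, he01, MvPolynomial.C_mul_X_eq_monomial]
    by_cases hu2 : u = Finsupp.single 1 1
    · subst hu2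
      simp [MvPolynomial.coeff_monomial, he1, he01.symm, MvPolynomial.C_mul_X_eq_monomial]
    -- generic monomial: the low terms vanish and `monomial u a = C a * monomial u 1 ∈ J`
    simp only [MvPolynomial.coeff_monomial, hu0, hu1, hu2, if_false, map_zero, zero_mul, add_zero, sub_zero]
    have hmon : monomial u (1 : k) ∈ Ideal.span ((fun s => monomial s (1 : k)) ''
        ({Finsupp.single 0 2, Finsupp.single 0 1 + Finsupp.single 1 1, Finsupp.single 1 2} :
          Set (Fin 2 →₀ ℕ))) := by
      rw [MvPolynomial.mem_ideal_span_monomial_image]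
      intro xi hxi
      have hxu : xi = u := by
        have := MvPolynomial.support_monomial_subset hxi
        simpa using this
      subst hxu
      -- `xi ∉ {0, e₀, e₁}` ⇒ it dominates one of the three generators
      have h0 : ¬ (xi 0 = 0 ∧ xi 1 = 0) := by
        rintro ⟨h0, h1⟩; apply hu0; ext i; fin_cases i <;> simp [h0, h1]
      have h1 : ¬ (xi 0 = 1 ∧ xi 1 = 0) := by
        rintro ⟨h0, h1⟩; apply hu1; ext i; fin_cases i <;> simp [h0, h1]
      have h2 : ¬ (xi 0 = 0 ∧ xi 1 = 1) := by
        rintro ⟨h0, h1⟩; apply hu2; ext i; fin_cases i <;> simp [h0, h1]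
      by_cases ha : 2 ≤ xi 0
      · exact ⟨Finsupp.single 0 2, by simp, by simpa [Finsupp.single_le_iff] using ha⟩
      by_cases hb : 2 ≤ xi 1
      · exact ⟨Finsupp.single 1 2, by simp, by simpa [Finsupp.single_le_iff] using hb⟩
      refine ⟨Finsupp.single 0 1 + Finsupp.single 1 1, by simp, ?_⟩
      have hc : 1 ≤ xi 0 ∧ 1 ≤ xi 1 := by omega
      intro i
      fin_cases i <;> simp [hc.1, hc.2]
    have : monomial u a = C a * monomial u (1 : k) := by
      rw [MvPolynomial.C_mul_monomial, mul_one]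
    rw [this]
    exact Ideal.mul_mem_left _ _ hmon
  | add p q hp hq =>
    have : p + q - (C (coeff 0 (p + q)) + C (coeff (Finsupp.single 0 1) (p + q)) * X 0 +
        C (coeff (Finsupp.single 1 1) (p + q)) * X 1) =
        (p - (C (coeff 0 p) + C (coeff (Finsupp.single 0 1) p) * X 0 + C (coeff (Finsupp.single 1 1) p) * X 1)) +
        (q - (C (coeff 0 q) + C (coeff (Finsupp.single 0 1) q) * X 0 + C (coeff (Finsupp.single 1 1) q) * X 1)) := by
      simp only [MvPolynomial.coeff_add, map_add]
      ring
    rw [this]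
    exact Ideal.add_mem _ hp hq

/-- The test map `τ : z ↦ −τ⁴, t ↦ τ³` sends `J = (z², zt, t²)` into `(τ⁶)` (`τ⁸, −τ⁷, τ⁶`). [folklore] -/
theorem map_J_le :
    (Ideal.span ((fun s => monomial s (1 : k)) ''
        ({Finsupp.single 0 2, Finsupp.single 0 1 + Finsupp.single 1 1, Finsupp.single 1 2} :
          Set (Fin 2 →₀ ℕ)))).map
      (MvPolynomial.aeval (R := k) (![-(Polynomial.X ^ 4), Polynomial.X ^ 3] : Fin 2 → Polynomial k)).toRingHom ≤
      Ideal.span ({Polynomial.X ^ 6} : Set (Polynomial k)) := by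
  rw [Ideal.map_span, Ideal.span_le]
  rintro _ ⟨_, ⟨s, hs, rfl⟩, rfl⟩
  simp only [Set.mem_insert_iff, Set.mem_singleton_iff] at hs
  rw [SetLike.mem_coe, Ideal.mem_span_singleton]
  rcases hs with rfl | rfl | rfl
  · refine ⟨Polynomial.X ^ 2, ?_⟩
    simp [MvPolynomial.aeval_monomial]
    ring
  · refine ⟨-Polynomial.X, ?_⟩
    simp [MvPolynomial.aeval_monomial]
    ring
  · refine ⟨1, ?_⟩
    simp [MvPolynomial.aeval_monomial]
    ring

/-- **COEFFICIENT LEMMA**: if `c(−τ⁴, τ³) ∈ (τ⁶)` in `k[τ]` then `c ∈ J = (z², zt, t²)` — the coefficients of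
`1, τ³, τ⁴` of `c(−τ⁴, τ³)` are `c₀, c_t, −c_z` (the weights `4i + 3j` take the values `0, 3, 4` only at
`(i,j) = (0,0), (0,1), (1,0)`), so they vanish, and the remaining terms of `c` lie in `J`. [folklore] -/
theorem mem_J_of_test_mem (c : MvPolynomial (Fin 2) k)
    (hc : (MvPolynomial.aeval (R := k) (![-(Polynomial.X ^ 4), Polynomial.X ^ 3] : Fin 2 → Polynomial k)).toRingHom c ∈
      Ideal.span ({Polynomial.X ^ 6} : Set (Polynomial k))) :
    c ∈ Ideal.span ((fun s => monomial s (1 : k)) ''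
        ({Finsupp.single 0 2, Finsupp.single 0 1 + Finsupp.single 1 1, Finsupp.single 1 2} :
          Set (Fin 2 →₀ ℕ))) := by
  set τ := (MvPolynomial.aeval (R := k) (![-(Polynomial.X ^ 4), Polynomial.X ^ 3] : Fin 2 → Polynomial k)).toRingHom
    with hτ
  have hr := sub_low_mem_J k c
  set r := c - (C (coeff 0 c) + C (coeff (Finsupp.single 0 1) c) * X 0 + C (coeff (Finsupp.single 1 1) c) * X 1)
    with hrdef
  -- the low part maps into `(τ⁶)` as well
  have hlow : τ (C (coeff 0 c) + C (coeff (Finsupp.single 0 1) c) * X 0 + C (coeff (Finsupp.single 1 1) c) * X 1) ∈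
      Ideal.span ({Polynomial.X ^ 6} : Set (Polynomial k)) := by
    have heq : C (coeff 0 c) + C (coeff (Finsupp.single 0 1) c) * X 0 + C (coeff (Finsupp.single 1 1) c) * X 1 =
        c - r := by rw [hrdef]; ring
    rw [heq, map_sub]
    exact Ideal.sub_mem _ hc (SetLike.le_def.mp (map_J_le k) (Ideal.mem_map_of_mem _ hr))
  -- read the coefficients of `1, τ³, τ⁴`
  have hval : τ (C (coeff 0 c) + C (coeff (Finsupp.single 0 1) c) * X 0 + C (coeff (Finsupp.single 1 1) c) * X 1) =
      Polynomial.C (coeff 0 c) - Polynomial.C (coeff (Finsupp.single 0 1) c) * Polynomial.X ^ 4 +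
        Polynomial.C (coeff (Finsupp.single 1 1) c) * Polynomial.X ^ 3 := by
    simp [hτ, Polynomial.algebraMap_eq]
    ring
  rw [hval, Ideal.mem_span_singleton, Polynomial.X_pow_dvd_iff] at hlow
  have h0 := hlow 0 (by norm_num)
  have h3 := hlow 3 (by norm_num)
  have h4 := hlow 4 (by norm_num)
  simp [Polynomial.coeff_X_pow, Polynomial.coeff_C] at h0 h3 h4
  have hc' : c = r := by
    rw [hrdef, h0, h3, h4]
    simp
  rw [hc']
  exact hr

end Curve

/-! ## The threefold: `a − ι(π a) ∈ (x, y)`, the Jacobian inputs, and the upper bound -/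

section Affine

variable (k : Type u) [Field k]

/-- `a − ι(π a) ∈ (x, y)` for the retraction `π : x, y ↦ 0` onto `k[z,t]` and the inclusion `ι`. [folklore] -/
theorem sub_inclusion_retraction_mem (a : MvPolynomial (Fin 4) k) :
    a - (MvPolynomial.aeval (![X 2, X 3] : Fin 2 → MvPolynomial (Fin 4) k))
        ((MvPolynomial.aeval (![0, 0, X 0, X 1] : Fin 4 → MvPolynomial (Fin 2) k)) a) ∈
      Ideal.span ({X 0, X 1} : Set (MvPolynomial (Fin 4) k)) := by
  induction a using MvPolynomial.induction_on with
  | C r => simp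
  | add p q hp hq =>
    have : p + q - (MvPolynomial.aeval (![X 2, X 3] : Fin 2 → MvPolynomial (Fin 4) k))
        ((MvPolynomial.aeval (![0, 0, X 0, X 1] : Fin 4 → MvPolynomial (Fin 2) k)) (p + q)) =
        (p - (MvPolynomial.aeval (![X 2, X 3] : Fin 2 → MvPolynomial (Fin 4) k))
          ((MvPolynomial.aeval (![0, 0, X 0, X 1] : Fin 4 → MvPolynomial (Fin 2) k)) p)) +
        (q - (MvPolynomial.aeval (![X 2, X 3] : Fin 2 → MvPolynomial (Fin 4) k))
          ((MvPolynomial.aeval (![0, 0, X 0, X 1] : Fin 4 → MvPolynomial (Fin 2) k)) q)) := by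
      simp only [map_add]; ring
    rw [this]
    exact Ideal.add_mem _ hp hq
  | mul_X p i hp =>
    have hX : ∀ j : Fin 4, (X j : MvPolynomial (Fin 4) k) -
        (MvPolynomial.aeval (![X 2, X 3] : Fin 2 → MvPolynomial (Fin 4) k))
          ((MvPolynomial.aeval (![0, 0, X 0, X 1] : Fin 4 → MvPolynomial (Fin 2) k))
            (X j : MvPolynomial (Fin 4) k)) ∈
        Ideal.span ({X 0, X 1} : Set (MvPolynomial (Fin 4) k)) := by
      intro j
      fin_cases j
      · simpa using (Ideal.subset_span (by simp) :
          (X 0 : MvPolynomial (Fin 4) k) ∈ Ideal.span ({X 0, X 1} : Set (MvPolynomial (Fin 4) k)))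
      · simpa using (Ideal.subset_span (by simp) :
          (X 1 : MvPolynomial (Fin 4) k) ∈ Ideal.span ({X 0, X 1} : Set (MvPolynomial (Fin 4) k)))
      · simp
      · simp
    have : p * X i - (MvPolynomial.aeval (![X 2, X 3] : Fin 2 → MvPolynomial (Fin 4) k))
        ((MvPolynomial.aeval (![0, 0, X 0, X 1] : Fin 4 → MvPolynomial (Fin 2) k)) (p * X i)) =
        (p - (MvPolynomial.aeval (![X 2, X 3] : Fin 2 → MvPolynomial (Fin 4) k))
          ((MvPolynomial.aeval (![0, 0, X 0, X 1] : Fin 4 → MvPolynomial (Fin 2) k)) p)) * X i +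
        (MvPolynomial.aeval (![X 2, X 3] : Fin 2 → MvPolynomial (Fin 4) k))
          ((MvPolynomial.aeval (![0, 0, X 0, X 1] : Fin 4 → MvPolynomial (Fin 2) k)) p) *
          (X i - (MvPolynomial.aeval (![X 2, X 3] : Fin 2 → MvPolynomial (Fin 4) k))
            ((MvPolynomial.aeval (![0, 0, X 0, X 1] : Fin 4 → MvPolynomial (Fin 2) k))
              (X i : MvPolynomial (Fin 4) k))) := by
      simp only [map_mul]
      ring
    rw [this]
    exact Ideal.add_mem _ (Ideal.mul_mem_right _ _ hp) (Ideal.mul_mem_left _ _ (hX i))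

/-- `∂f/∂y = x` for `f = x y − z³ − t⁴`. [folklore] -/
theorem pderiv_one_f :
    MvPolynomial.pderiv 1 (X 0 * X 1 - X 2 ^ 3 - X 3 ^ 4 : MvPolynomial (Fin 4) k) = X 0 := by
  simp [map_sub, Derivation.leibniz, Derivation.leibniz_pow, MvPolynomial.pderiv_X]

/-- `∂f/∂x = y` for `f = x y − z³ − t⁴`. [folklore] -/
theorem pderiv_zero_f :
    MvPolynomial.pderiv 0 (X 0 * X 1 - X 2 ^ 3 - X 3 ^ 4 : MvPolynomial (Fin 4) k) = X 1 := by
  simp [map_sub, Derivation.leibniz, Derivation.leibniz_pow, MvPolynomial.pderiv_X]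

/-- `x̄ ∈ ca⁴(A)` (res-D-pv-058's K1 `pderiv_mem_cohomologyAnnihilatorOfDegree` at `∂f/∂y = x`). [folklore] -/
theorem mk_X0_mem_cohomologyAnnihilatorOfDegree_four :
    Ideal.Quotient.mk (Ideal.span ({X 0 * X 1 - X 2 ^ 3 - X 3 ^ 4} : Set (MvPolynomial (Fin 4) k))) (X 0) ∈
      cohomologyAnnihilatorOfDegree (MvPolynomial (Fin 4) k ⧸
        Ideal.span ({X 0 * X 1 - X 2 ^ 3 - X 3 ^ 4} : Set (MvPolynomial (Fin 4) k))) 4 := by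
  have h := pderiv_mem_cohomologyAnnihilatorOfDegree (d := 3)
    (X 0 * X 1 - X 2 ^ 3 - X 3 ^ 4 : MvPolynomial (Fin 4) k) (f_ne_zero k) 1
  rwa [pderiv_one_f] at h

/-- `ȳ ∈ ca⁴(A)` (K1 at `∂f/∂x = y`). [folklore] -/
theorem mk_X1_mem_cohomologyAnnihilatorOfDegree_four :
    Ideal.Quotient.mk (Ideal.span ({X 0 * X 1 - X 2 ^ 3 - X 3 ^ 4} : Set (MvPolynomial (Fin 4) k))) (X 1) ∈
      cohomologyAnnihilatorOfDegree (MvPolynomial (Fin 4) k ⧸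
        Ideal.span ({X 0 * X 1 - X 2 ^ 3 - X 3 ^ 4} : Set (MvPolynomial (Fin 4) k))) 4 := by
  have h := pderiv_mem_cohomologyAnnihilatorOfDegree (d := 3)
    (X 0 * X 1 - X 2 ^ 3 - X 3 ^ 4 : MvPolynomial (Fin 4) k) (f_ne_zero k) 0
  rwa [pderiv_zero_f] at h

/-- For `c ∈ k[z,t]`: if `ι c‾ ∈ caⁿ(A)` then `c(−τ⁴, τ³) ∈ (τ⁶)` — the contrapositive of the conductor criterion
`not_mem_cohomologyAnnihilatorOfDegree_of_map_not_mem` (p527657) at the affine instance. [OURS · L1 w44b] -/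
theorem test_mem_of_mk_inclusion_mem (c : MvPolynomial (Fin 2) k) (n : ℕ)
    (h : Ideal.Quotient.mk (Ideal.span ({X 0 * X 1 - X 2 ^ 3 - X 3 ^ 4} : Set (MvPolynomial (Fin 4) k)))
        ((MvPolynomial.aeval (![X 2, X 3] : Fin 2 → MvPolynomial (Fin 4) k)) c) ∈
      cohomologyAnnihilatorOfDegree (MvPolynomial (Fin 4) k ⧸
        Ideal.span ({X 0 * X 1 - X 2 ^ 3 - X 3 ^ 4} : Set (MvPolynomial (Fin 4) k))) n) :
    (MvPolynomial.aeval (R := k) (![-(Polynomial.X ^ 4), Polynomial.X ^ 3] : Fin 2 → Polynomial k)).toRingHom c ∈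
      Ideal.span ({Polynomial.X ^ 6} : Set (Polynomial k)) := by
  let ι : MvPolynomial (Fin 2) k →ₐ[k] MvPolynomial (Fin 4) k := MvPolynomial.aeval ![X 2, X 3]
  let π : MvPolynomial (Fin 4) k →ₐ[k] MvPolynomial (Fin 2) k := MvPolynomial.aeval ![0, 0, X 0, X 1]
  let τ : MvPolynomial (Fin 2) k →ₐ[k] Polynomial k := MvPolynomial.aeval ![-(Polynomial.X ^ 4), Polynomial.X ^ 3]
  by_contra hc
  refine not_mem_cohomologyAnnihilatorOfDegree_of_map_not_mem ι.toRingHom π.toRingHom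
    (retraction_comp_inclusion k) τ.toRingHom (X 0) (X 1) Polynomial.X (by simp [τ]) (by simp [τ]) (X 0) (X 1)
    (by simp [π]) (by simp [π]) ?_ (f_mem_nonZeroDivisors k) hc n h
  simp [ι]
  ring

/-- `ι(J) ⊆ I′ = (x, y, z², zt, t²)` in `k[x,y,z,t]`. [folklore] -/
theorem map_inclusion_J_le :
    (Ideal.span ((fun s => monomial s (1 : k)) ''
        ({Finsupp.single 0 2, Finsupp.single 0 1 + Finsupp.single 1 1, Finsupp.single 1 2} :
          Set (Fin 2 →₀ ℕ)))).map
      (MvPolynomial.aeval (![X 2, X 3] : Fin 2 → MvPolynomial (Fin 4) k)).toRingHom ≤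
      Ideal.span ({X 0, X 1, X 2 ^ 2, X 2 * X 3, X 3 ^ 2} : Set (MvPolynomial (Fin 4) k)) := by
  rw [Ideal.map_span, Ideal.span_le]
  rintro _ ⟨_, ⟨s, hs, rfl⟩, rfl⟩
  simp only [Set.mem_insert_iff, Set.mem_singleton_iff] at hs
  rcases hs with rfl | rfl | rfl
  · have : (MvPolynomial.aeval (![X 2, X 3] : Fin 2 → MvPolynomial (Fin 4) k)).toRingHom
        (monomial (Finsupp.single 0 2) (1 : k)) = X 2 ^ 2 := by
      simp [MvPolynomial.bind₁_monomial]
    rw [this]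
    exact Ideal.subset_span (by simp)
  · have hm : (monomial (Finsupp.single (0 : Fin 2) 1 + Finsupp.single 1 1) (1 : k) : MvPolynomial (Fin 2) k) =
        X 0 * X 1 := by
      rw [MvPolynomial.X, MvPolynomial.X, MvPolynomial.monomial_mul, mul_one]
    have : (MvPolynomial.aeval (![X 2, X 3] : Fin 2 → MvPolynomial (Fin 4) k)).toRingHom
        (monomial (Finsupp.single 0 1 + Finsupp.single 1 1) (1 : k)) = X 2 * X 3 := by
      rw [hm]
      simp
    rw [this]
    exact Ideal.subset_span (by simp)
  · have : (MvPolynomial.aeval (![X 2, X 3] : Fin 2 → MvPolynomial (Fin 4) k)).toRingHom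
        (monomial (Finsupp.single 1 2) (1 : k)) = X 3 ^ 2 := by
      simp [MvPolynomial.bind₁_monomial]
    rw [this]
    exact Ideal.subset_span (by simp)

/-- **K2-UPPER COMPLETE (OURS · w44b K-C3): `caᵐ(A) ⊆ I·A` for every field `k` and every `m`**,
`A = k[x,y,z,t] ⧸ (x y − z³ − t⁴)`, `I = (x, y, z², zt, t²)` — unconditional, affine. Proof: `ā ∈ caᵐ`; `a = ι(π a) + b`,
`b ∈ (x,y) ⊆ ca⁴` (K1), so `ι(π a)‾ ∈ ca^{max(m,4)}`; the conductor criterion gives `(π a)(−τ⁴,τ³) ∈ (τ⁶)`, the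
coefficient lemma gives `π a ∈ (z², zt, t²)`, hence `a ∈ I`. [OURS · L1 w44b] -/
theorem cohomologyAnnihilatorOfDegree_le_map_I (m : ℕ) :
    cohomologyAnnihilatorOfDegree (MvPolynomial (Fin 4) k ⧸
        Ideal.span ({X 0 * X 1 - X 2 ^ 3 - X 3 ^ 4} : Set (MvPolynomial (Fin 4) k))) m ≤
      (Ideal.span ({X 0, X 1, X 2 ^ 2, X 2 * X 3, X 3 ^ 2} : Set (MvPolynomial (Fin 4) k))).map
        (Ideal.Quotient.mk (Ideal.span ({X 0 * X 1 - X 2 ^ 3 - X 3 ^ 4} : Set (MvPolynomial (Fin 4) k)))) := by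
  intro abar habar
  obtain ⟨a, rfl⟩ := Ideal.Quotient.mk_surjective abar
  set f : MvPolynomial (Fin 4) k := X 0 * X 1 - X 2 ^ 3 - X 3 ^ 4 with hf
  set ι : MvPolynomial (Fin 2) k →ₐ[k] MvPolynomial (Fin 4) k := MvPolynomial.aeval ![X 2, X 3] with hι
  set π : MvPolynomial (Fin 4) k →ₐ[k] MvPolynomial (Fin 2) k := MvPolynomial.aeval ![0, 0, X 0, X 1] with hπ
  set N := max m 4 with hN
  -- `b = a − ι(π a) ∈ (x, y)`, and `(x̄, ȳ) ⊆ ca⁴ ⊆ ca^N`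
  have hb := sub_inclusion_retraction_mem k a
  have hxy : (Ideal.span ({X 0, X 1} : Set (MvPolynomial (Fin 4) k))).map (Ideal.Quotient.mk (Ideal.span {f})) ≤
      cohomologyAnnihilatorOfDegree (MvPolynomial (Fin 4) k ⧸ Ideal.span {f}) N := by
    rw [Ideal.map_span, Ideal.span_le]
    rintro _ ⟨g, hg, rfl⟩
    simp only [Set.mem_insert_iff, Set.mem_singleton_iff] at hg
    rcases hg with rfl | rfl
    · exact cohomologyAnnihilatorOfDegree_mono (le_max_right m 4)
        (mk_X0_mem_cohomologyAnnihilatorOfDegree_four k)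
    · exact cohomologyAnnihilatorOfDegree_mono (le_max_right m 4)
        (mk_X1_mem_cohomologyAnnihilatorOfDegree_four k)
  have hbN : Ideal.Quotient.mk (Ideal.span {f}) (a - ι (π a)) ∈
      cohomologyAnnihilatorOfDegree (MvPolynomial (Fin 4) k ⧸ Ideal.span {f}) N :=
    SetLike.le_def.mp hxy (Ideal.mem_map_of_mem _ hb)
  have haN : Ideal.Quotient.mk (Ideal.span {f}) a ∈
      cohomologyAnnihilatorOfDegree (MvPolynomial (Fin 4) k ⧸ Ideal.span {f}) N :=
    cohomologyAnnihilatorOfDegree_mono (le_max_left m 4) habar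
  have hιN : Ideal.Quotient.mk (Ideal.span {f}) (ι (π a)) ∈
      cohomologyAnnihilatorOfDegree (MvPolynomial (Fin 4) k ⧸ Ideal.span {f}) N := by
    have : ι (π a) = a - (a - ι (π a)) := by ring
    rw [this, map_sub]
    exact Ideal.sub_mem _ haN hbN
  -- the conductor criterion + the coefficient lemma: `π a ∈ J`
  have hJ := mem_J_of_test_mem k (π a) (test_mem_of_mk_inclusion_mem k (π a) N hιN)
  -- hence `a = ι(π a) + b ∈ I`
  have hIxy : Ideal.span ({X 0, X 1} : Set (MvPolynomial (Fin 4) k)) ≤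
      Ideal.span ({X 0, X 1, X 2 ^ 2, X 2 * X 3, X 3 ^ 2} : Set (MvPolynomial (Fin 4) k)) :=
    Ideal.span_mono (by intro g hg; simp only [Set.mem_insert_iff, Set.mem_singleton_iff] at hg ⊢; tauto)
  have hιa : ι (π a) ∈ Ideal.span ({X 0, X 1, X 2 ^ 2, X 2 * X 3, X 3 ^ 2} : Set (MvPolynomial (Fin 4) k)) :=
    SetLike.le_def.mp (map_inclusion_J_le k) (Ideal.mem_map_of_mem _ hJ)
  have ha : a ∈ Ideal.span ({X 0, X 1, X 2 ^ 2, X 2 * X 3, X 3 ^ 2} : Set (MvPolynomial (Fin 4) k)) := by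
    have : a = ι (π a) + (a - ι (π a)) := by ring
    rw [this]
    exact Ideal.add_mem _ hιa (SetLike.le_def.mp hIxy hb)
  exact Ideal.mem_map_of_mem _ ha

/-- **`ca(A) ⊆ I·A`** for the full cohomology annihilator `ca = ⋃ₘ caᵐ`, `A = k[x,y,z,t] ⧸ (x y − z³ − t⁴)`,
`I = (x, y, z², zt, t²)`, every field `k`. [OURS · L1 w44b] -/
theorem cohomologyAnnihilator_le_map_I :
    cohomologyAnnihilator (MvPolynomial (Fin 4) k ⧸
        Ideal.span ({X 0 * X 1 - X 2 ^ 3 - X 3 ^ 4} : Set (MvPolynomial (Fin 4) k))) ≤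
      (Ideal.span ({X 0, X 1, X 2 ^ 2, X 2 * X 3, X 3 ^ 2} : Set (MvPolynomial (Fin 4) k))).map
        (Ideal.Quotient.mk (Ideal.span ({X 0 * X 1 - X 2 ^ 3 - X 3 ^ 4} : Set (MvPolynomial (Fin 4) k)))) := by
  intro a ha
  rw [mem_cohomologyAnnihilator_iff] at ha
  obtain ⟨m, hm⟩ := ha
  exact cohomologyAnnihilatorOfDegree_le_map_I k m hm

end Affine

end Summit.ResolutionOfSingularities.ResolutionOfSingularities.Theorems.HomologicalConductor.KC3Upper

end
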